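import Literature.Topology.FourManifolds.TwoHandleTubeCoordinates
import Literature.Topology.FourManifolds.ConnectedSumEulerCharacteristic
import Literature.Topology.FourManifolds.BoundaryManifoldHomologyVanishing
import Literature.AlgebraicTopology.SingularHomology.EulerCharacteristicTriple
import HarnessLib

/-!
# The Euler characteristic of a Kosinski multi-attachment of 2-handles: `χ(V ∪ n H²) = χ(V) + n`
(helper of sub-goal `stub_modelsOn_counts_length_of_betti` of stub `stub_modelsOn_counts`, line
`modp-braid-orbits`, reshape r9, crux `ConvexBisection.AcyclicBisectionExists`, item stmt-SmoothPoincare4-10508)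

The input `hχ` of `stub_modelsOn_counts_length_of_betti` (`…EulerCounts.lean`): for a Kosinski multi-attachment
`X` of `n` 2-handles on a compact manifold with boundary `V` (`HandleAttachingMap.IsMultiAttachment`, Kosinski
1993, VI §6: `X` is covered by open embeddings of `C = V ∖ ⋃ h̄ᵢ(S)` and of one handle piece `D ∖ S` per
handle, glued along the punctured tubes `T ∖ S`), **`χ(X) = χ(V) + n`** (Kirby 1989, I §1).  Proof by
inclusion–exclusion of the tree's `relEuler ℤ ℤ · ∅` over open covers (Hatcher 2002, Thm. 2.44 with excision;
the tree's `finRelHomology_and_relEuler_of_isOpen_cover`, `FinRelHomology.triple_left/right`): `χ` is additive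
over finite disjoint open unions (`…_union_of_disjoint`, `…_biUnion`, `…_iUnion`), two out of three for a piece
(`…_of_isOpen_cover_left`); **`χ(V ∖ ⋃ h̄ᵢ(S)) = χ(V)`** over `V = C ∪ ⋃ h̄ᵢ(T)`, `C ∩ h̄ᵢ(T) = h̄ᵢ(T ∖ S)`
(`finRelHomology_and_relEuler_coresComplement`); **`χ(X) = χ(C) + n`** over `X = jA(C) ∪ ⋃ jBᵢ(D ∖ S)`,
`jA(C) ∩ jBᵢ(D ∖ S) = jBᵢ({x_λ ≠ 0})` (`…_of_isMultiAttachment'`); and the four-dimensional reading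
`stub_modelsOn_counts_eulerHandles` in the shape of `hχ`.  The Euler characteristics of the model pieces
(`χ(T) = χ(T ∖ S) = χ({x_λ ≠ 0}) = 0`, `χ(D ∖ S) = 1`) enter as explicit hypotheses; they are proved in the
companion `…EulerHandleModels.lean` of this wave (not importable on the day of writing).  Everything here is
proved; no definitions, no named facts, no `sorry`.
-/
noncomputable section

-- the prescribed namespace `Summit.<P>.<Sub>.…` duplicates `SmoothPoincare4` (P = Sub)
set_option linter.dupNamespace false

open scoped Manifold ContDiff Topology ContinuousMap
open Set Function Metric CategoryTheory CategoryTheory.Limits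
open Literature.AlgebraicTopology.SingularHomology Literature.Topology.FourManifolds

namespace Summit.SmoothPoincare4.SmoothPoincare4.Theorems.AcyclicBisectionExists.ModpBraidOrbits

section General

/-- The Euler characteristic of an empty space is `0` and its homology is bounded by `0`. [folklore] -/
theorem finRelHomology_and_relEuler_of_isEmpty (X : Type) [TopologicalSpace X] [IsEmpty X] (N : ℕ) :
    FinRelHomology ℤ ℤ X ∅ N ∧ relEuler ℤ ℤ X ∅ = 0 :=
  ⟨(FinRelHomology.of_isEmpty _).mono (Nat.zero_le _),
    relEuler_eq_zero_of_isZero fun k => (FinRelHomology.of_isEmpty (R := ℤ) (M := ℤ) (X := X) ∅).isZero k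
      (Nat.zero_le _)⟩

end General

section Covers

variable {P : Type} [TopologicalSpace P]

/-- **`χ(U ⊔ V) = χ(U) + χ(V)` for disjoint open subsets** of finite homological type (the tree's
inclusion–exclusion `finRelHomology_and_relEuler_of_isOpen_cover` on the subspace `U ∪ V`, whose
traces of `U`, `V` are copies of `U`, `V` meeting in the empty set). [folklore] -/
theorem finRelHomology_and_relEuler_union_of_disjoint {U V : Set P} (hU : IsOpen U) (hV : IsOpen V)
    (hUV : Disjoint U V) {N : ℕ} (hFU : FinRelHomology ℤ ℤ ↥U ∅ N) (hFV : FinRelHomology ℤ ℤ ↥V ∅ N) :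
    FinRelHomology ℤ ℤ ↥(U ∪ V) ∅ (N + 1) ∧
      relEuler ℤ ℤ ↥(U ∪ V) ∅ = relEuler ℤ ℤ ↥U ∅ + relEuler ℤ ℤ ↥V ∅ := by
  have hU' : IsOpen (Subtype.val ⁻¹' U : Set ↥(U ∪ V)) := hU.preimage continuous_subtype_val
  have hV' : IsOpen (Subtype.val ⁻¹' V : Set ↥(U ∪ V)) := hV.preimage continuous_subtype_val
  have hcov : (Subtype.val ⁻¹' U : Set ↥(U ∪ V)) ∪ Subtype.val ⁻¹' V = univ :=
    eq_univ_of_forall fun x => x.2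
  let eU : ↥(Subtype.val ⁻¹' U : Set ↥(U ∪ V)) ≃ₜ ↥U := preimageValHomeomorphOfSubset subset_union_left
  let eV : ↥(Subtype.val ⁻¹' V : Set ↥(U ∪ V)) ≃ₜ ↥V := preimageValHomeomorphOfSubset subset_union_right
  have hFU' : FinRelHomology ℤ ℤ ↥(Subtype.val ⁻¹' U : Set ↥(U ∪ V)) ∅ N :=
    hFU.of_homeomorph eU.symm (mapsTo_empty _ _) (mapsTo_empty _ _)
  have hFV' : FinRelHomology ℤ ℤ ↥(Subtype.val ⁻¹' V : Set ↥(U ∪ V)) ∅ N :=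
    hFV.of_homeomorph eV.symm (mapsTo_empty _ _) (mapsTo_empty _ _)
  haveI : IsEmpty ↥((Subtype.val ⁻¹' U : Set ↥(U ∪ V)) ∩ Subtype.val ⁻¹' V) :=
    ⟨fun x => Set.disjoint_left.1 hUV x.2.1 x.2.2⟩
  obtain ⟨hFI, hIe⟩ := finRelHomology_and_relEuler_of_isEmpty
    (↥((Subtype.val ⁻¹' U : Set ↥(U ∪ V)) ∩ Subtype.val ⁻¹' V)) N
  obtain ⟨hW, hWe⟩ := finRelHomology_and_relEuler_of_isOpen_cover hU' hV' hcov hFU' hFV' hFI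
  refine ⟨hW, ?_⟩
  rw [hWe, hIe, sub_zero, ← relEuler_eq_of_homeomorph eU.symm (mapsTo_empty _ _) (mapsTo_empty _ _),
    ← relEuler_eq_of_homeomorph eV.symm (mapsTo_empty _ _) (mapsTo_empty _ _)]

/-- **`χ(⊔ᵢ Vᵢ) = Σᵢ χ(Vᵢ)` for finitely many pairwise disjoint open subsets** of finite homological
type (induction on the two-piece case). [folklore] -/
theorem finRelHomology_and_relEuler_biUnion {ι : Type} (V : ι → Set P) (hV : ∀ i, IsOpen (V i))
    (hdisj : Pairwise fun i j => Disjoint (V i) (V j)) {N : ℕ}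
    (hF : ∀ i, FinRelHomology ℤ ℤ ↥(V i) ∅ N) (s : Finset ι) :
    FinRelHomology ℤ ℤ ↥(⋃ i ∈ s, V i) ∅ (N + s.card) ∧
      relEuler ℤ ℤ ↥(⋃ i ∈ s, V i) ∅ = ∑ i ∈ s, relEuler ℤ ℤ ↥(V i) ∅ := by
  classical
  induction s using Finset.induction_on with
  | empty =>
    have he : (⋃ i ∈ (∅ : Finset ι), V i) = ∅ := by simp
    rw [he, Finset.sum_empty, Finset.card_empty, add_zero]
    exact finRelHomology_and_relEuler_of_isEmpty _ N
  | insert a s ha ih =>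
    rw [Finset.set_biUnion_insert, Finset.sum_insert ha, Finset.card_insert_of_notMem ha, ← add_assoc]
    have hdisj' : Disjoint (V a) (⋃ i ∈ s, V i) :=
      disjoint_iUnion₂_right.2 fun i hi => hdisj fun h => ha (h ▸ hi)
    have hopen : IsOpen (⋃ i ∈ s, V i) := isOpen_biUnion fun i _ => hV i
    obtain ⟨h1, h2⟩ := finRelHomology_and_relEuler_union_of_disjoint (hV a) hopen hdisj'
      ((hF a).mono (Nat.le_add_right _ _)) ih.1
    exact ⟨h1, by rw [h2, ih.2]⟩

/-- The `Fintype` form: `χ(⊔ᵢ Vᵢ) = Σᵢ χ(Vᵢ)` over all indices. [folklore] -/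
theorem finRelHomology_and_relEuler_iUnion {ι : Type} [Fintype ι] (V : ι → Set P) (hV : ∀ i, IsOpen (V i))
    (hdisj : Pairwise fun i j => Disjoint (V i) (V j)) {N : ℕ}
    (hF : ∀ i, FinRelHomology ℤ ℤ ↥(V i) ∅ N) :
    FinRelHomology ℤ ℤ ↥(⋃ i, V i) ∅ (N + Fintype.card ι) ∧
      relEuler ℤ ℤ ↥(⋃ i, V i) ∅ = ∑ i, relEuler ℤ ℤ ↥(V i) ∅ := by
  have h := finRelHomology_and_relEuler_biUnion V hV hdisj hF Finset.univ
  have he : (⋃ i ∈ (Finset.univ : Finset ι), V i) = ⋃ i, V i := by simp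
  rw [he, Finset.card_univ] at h
  exact h

/-- **`χ(U ∪ V) = χ(U) + χ(V) - χ(U ∩ V)`, two out of three for the piece `U`**: for an open cover
`P = U ∪ V`, if `P`, `V` and `U ∩ V` have finite homological type then so does `U`, and the count holds
(Hatcher 2002, Thm. 2.44 along `∅ ⊆ U ∩ V ⊆ V` and `∅ ⊆ U ⊆ P`, with excision `H_•(V, U ∩ V) ≅ H_•(P, U)`,
Thm. 2.20; the tree's `FinRelHomology.triple_right/left`). [folklore] -/
theorem finRelHomology_and_relEuler_of_isOpen_cover_left {U V : Set P} (hU : IsOpen U) (hV : IsOpen V)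
    (hUV : U ∪ V = univ) {N : ℕ} (hFP : FinRelHomology ℤ ℤ P ∅ N)
    (hFV : FinRelHomology ℤ ℤ ↥V ∅ N) (hFUV : FinRelHomology ℤ ℤ ↥(U ∩ V) ∅ N) :
    FinRelHomology ℤ ℤ ↥U ∅ (N + 1) ∧
      relEuler ℤ ℤ P ∅ = relEuler ℤ ℤ ↥U ∅ + relEuler ℤ ℤ ↥V ∅ - relEuler ℤ ℤ ↥(U ∩ V) ∅ := by
  have hint : interior U ∪ interior V = univ := by rw [hU.interior_eq, hV.interior_eq, hUV]
  let e : ↥(U ∩ V) ≃ₜ ↥(Subtype.val ⁻¹' U : Set ↥V) :=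
    (Homeomorph.setCongr (inter_comm U V)).trans (preimageValHomeomorph V U).symm
  have hW : FinRelHomology ℤ ℤ ↥(Subtype.val ⁻¹' U : Set ↥V) (Subtype.val ⁻¹' ∅) N :=
    (hFUV.of_homeomorph e (mapsTo_empty _ _) (mapsTo_empty _ _)).congr_set (preimage_empty).symm
  have hWe : relEuler ℤ ℤ ↥(Subtype.val ⁻¹' U : Set ↥V) (Subtype.val ⁻¹' ∅) =
      relEuler ℤ ℤ ↥(U ∩ V) ∅ := by
    rw [relEuler_congr_set (R := ℤ) (M := ℤ) (X := ↥(Subtype.val ⁻¹' U : Set ↥V))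
      (preimage_empty (f := (Subtype.val : ↥(Subtype.val ⁻¹' U : Set ↥V) → ↥V)))]
    exact (relEuler_eq_of_homeomorph (R := ℤ) (M := ℤ) (A := (∅ : Set ↥(U ∩ V))) e
      (mapsTo_empty _ _) (mapsTo_empty _ _)).symm
  obtain ⟨hVW, hVWe⟩ := FinRelHomology.triple_right (R := ℤ) (M := ℤ)
    (empty_subset (Subtype.val ⁻¹' U : Set ↥V)) hW hFV
  have hexc := relativeSingularHomology.isIso_map_of_interior_union_interior_holds ℤ ℤ P U V hint
  let ex : ∀ k, relativeSingularHomology ℤ ℤ ↥V (Subtype.val ⁻¹' U) k ≅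
      relativeSingularHomology ℤ ℤ P U k := fun k =>
    @asIso _ _ _ _ (relativeSingularHomology.map ℤ ℤ (X := ↥V) (subsetIncl V)
      (mapsTo_preimage Subtype.val U : MapsTo _ (Subtype.val ⁻¹' U) U) k) (hexc k)
  have hPU : FinRelHomology ℤ ℤ P U (N + 1) := hVW.of_iso ex
  have hPUe : relEuler ℤ ℤ ↥V (Subtype.val ⁻¹' U) = relEuler ℤ ℤ P U := relEuler_eq_of_iso ex
  obtain ⟨hUfin, hPe⟩ := FinRelHomology.triple_left (R := ℤ) (M := ℤ) (empty_subset U)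
    (hFP.mono (Nat.le_succ N)) hPU
  refine ⟨hUfin.congr_set preimage_empty, ?_⟩
  rw [hPe, relEuler_congr_set (R := ℤ) (M := ℤ) (X := ↥U)
    (preimage_empty (f := (Subtype.val : ↥U → P))), ← hPUe]
  rw [hWe] at hVWe
  linarith

end Covers

section Handles

variable {m : ℕ} {V : Type} [TopologicalSpace V] [T2Space V]
  [ChartedSpace (EuclideanHalfSpace (m + 1 + 1)) V] {ι : Type} [Fintype ι]

omit [T2Space V] in
/-- A point `h̄(y)` of a tube is on the attaching circle iff `|y_λ| = 1`. [folklore] -/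
theorem apply_mem_core_iff' (g : HandleAttachingMap (m + 1) 2 V) (y : ↥(handleTube (m + 1) 2)) :
    g.toFun y ∈ g.core ↔ lamSq 2 (tubeVecG m y) = 1 := by
  rw [HandleAttachingMap.mem_core_iff]
  constructor
  · rintro ⟨y', hy', he⟩
    rw [← g.injective he]
    exact hy'
  · intro hy
    exact ⟨y, hy, rfl⟩

/-- **`V` is covered by the complement of the attaching circles and the tubes.** [folklore] -/
theorem coresComplement_union_iUnion_range (h : ι → HandleAttachingMap (m + 1) 2 V) :
    (HandleAttachingMap.coresComplement h : Set V) ∪ ⋃ i, range (h i).toFun = univ := by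
  refine eq_univ_of_forall fun x => or_iff_not_imp_left.2 fun hx => ?_
  obtain ⟨i, hi⟩ : ∃ i, x ∈ (h i).core := by simpa [HandleAttachingMap.mem_coresComplement] using hx
  obtain ⟨y, -, rfl⟩ := (HandleAttachingMap.mem_core_iff _).1 hi
  exact mem_iUnion.2 ⟨i, mem_range_self y⟩

/-- With pairwise disjoint tubes: **the trace of the `i`-th tube on the complement of the attaching
circles is the image of the punctured tube `T ∖ S`** (Kosinski 1993, VI §6). [folklore] -/
theorem coresComplement_inter_range {h : ι → HandleAttachingMap (m + 1) 2 V}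
    (hdisj : Pairwise fun i j => Disjoint (range (h i).toFun) (range (h j).toFun)) (i : ι) :
    (HandleAttachingMap.coresComplement h : Set V) ∩ range (h i).toFun =
      (h i).toFun '' {y : ↥(handleTube (m + 1) 2) | lamSq 2 (tubeVecG m y) ≠ 1} := by
  ext a
  constructor
  · rintro ⟨ha, y, rfl⟩
    refine ⟨y, fun hy => ?_, rfl⟩
    exact (HandleAttachingMap.mem_coresComplement h).1 ha i ((apply_mem_core_iff' (h i) y).2 hy)
  · rintro ⟨y, hy, rfl⟩
    refine ⟨(HandleAttachingMap.mem_coresComplement h).2 fun j hj => ?_, mem_range_self y⟩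
    by_cases hji : j = i
    · subst hji
      exact hy ((apply_mem_core_iff' (h j) y).1 hj)
    · obtain ⟨y', -, hy'⟩ := (HandleAttachingMap.mem_core_iff _).1 hj
      exact Set.disjoint_left.1 (hdisj (Ne.symm hji)) (mem_range_self y) ⟨y', hy'⟩

/-- **The gluing region of the `i`-th handle piece**: `jA(V ∖ ⋃ h̄ⱼ(S)) ∩ jBᵢ(D ∖ S) = jBᵢ({x_λ ≠ 0})`
(read through Kosinski's involution `α`; Kosinski 1993, VI §6). [folklore] -/
theorem range_jA_inter_range_jB {h : ι → HandleAttachingMap (m + 1) 2 V} {X : Type}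
    {jA : ↥(HandleAttachingMap.coresComplement h) → X} {jB : ι → ↥(beltPiece (m + 1) 2) → X}
    (hdisj : Pairwise fun i j => Disjoint (range (h i).toFun) (range (h j).toFun))
    (hglue : ∀ i a b, jA a = jB i b ↔
      (h i).glueRel (a : V) (b : Metric.closedBall (0 : EuclideanSpace ℝ (Fin (m + 1 + 1))) 1))
    (i : ι) :
    range jA ∩ range (jB i) = jB i '' {b : ↥(beltPiece (m + 1) 2) |
      lamSq 2 ((b : Metric.closedBall (0 : EuclideanSpace ℝ (Fin (m + 2))) 1) : EuclideanSpace ℝ (Fin (m + 2))) ≠ 0} := by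
  ext w
  constructor
  · rintro ⟨⟨a, rfl⟩, b, hb⟩
    exact ⟨b, ((hglue i a b).1 hb.symm).lamSq_ne_zero, hb⟩
  · rintro ⟨b, hb0, rfl⟩
    have hb1 : lamSq 2 ((b : Metric.closedBall (0 : EuclideanSpace ℝ (Fin (m + 2))) 1) :
        EuclideanSpace ℝ (Fin (m + 2))) ≠ 1 := b.2
    set y : ↥(handleTube (m + 1) 2) := handleInversionPt b.1 hb0 hb1 with hy
    have hy1 : lamSq 2 (tubeVecG m y) ≠ 1 := (handleInversion_mem hb0 hb1).2.2
    have hya : (h i).toFun y ∈ HandleAttachingMap.coresComplement h := by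
      have := coresComplement_inter_range hdisj i
      have hmem : (h i).toFun y ∈ (HandleAttachingMap.coresComplement h : Set V) ∩ range (h i).toFun := by
        rw [this]; exact ⟨y, hy1, rfl⟩
      exact hmem.1
    refine ⟨⟨⟨(h i).toFun y, hya⟩, ?_⟩, mem_range_self _⟩
    rw [hglue i]
    refine ⟨y, hy1, ?_, rfl⟩
    change ((b.1 : Metric.closedBall (0 : EuclideanSpace ℝ (Fin (m + 2))) 1) : EuclideanSpace ℝ (Fin (m + 2))) =
      handleInversion 2 (handleInversion 2 ((b.1 : Metric.closedBall (0 : EuclideanSpace ℝ (Fin (m + 2))) 1) :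
        EuclideanSpace ℝ (Fin (m + 2))))
    have h0' : 0 < lamSq 2 ((b : Metric.closedBall (0 : EuclideanSpace ℝ (Fin (m + 2))) 1) :
        EuclideanSpace ℝ (Fin (m + 2))) := lt_of_le_of_ne (lamSq_nonneg 2 _) (Ne.symm hb0)
    have h1' : lamSq 2 ((b : Metric.closedBall (0 : EuclideanSpace ℝ (Fin (m + 2))) 1) :
        EuclideanSpace ℝ (Fin (m + 2))) < 1 :=
      lt_of_le_of_ne (lamSq_le_one (mem_closedBall_zero_iff.1 b.1.2)) hb1
    rw [handleInversion_handleInversion h0' h1']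

/-- **Removing the attaching circles does not change the Euler characteristic**: for attaching maps
`h̄ᵢ : T → V` of 2-handles with pairwise disjoint ranges on a compact manifold with boundary `V`, the
open piece `C = V ∖ ⋃ h̄ᵢ(S)` has integral homology of finite type and `χ(C) = χ(V)` — inclusion–exclusion
over the open cover `V = C ∪ ⋃ᵢ h̄ᵢ(T)` with `C ∩ h̄ᵢ(T) = h̄ᵢ(T ∖ S)`, where `χ(T) = χ(T ∖ S) = χ(S¹) = 0`
(Kosinski 1993, VI §6: `T` is a tubular neighbourhood of the circle `S`). [folklore] -/
theorem finRelHomology_and_relEuler_coresComplement [CompactSpace V] [IsManifold (𝓡∂ (m + 1 + 1)) ∞ V]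
    (hT : FinRelHomology ℤ ℤ ↥(handleTube (m + 1) 2) ∅ 2 ∧ relEuler ℤ ℤ ↥(handleTube (m + 1) 2) ∅ = 0)
    (hTS : FinRelHomology ℤ ℤ ↥{y : ↥(handleTube (m + 1) 2) | lamSq 2 (tubeVecG m y) ≠ 1} ∅ 2 ∧
      relEuler ℤ ℤ ↥{y : ↥(handleTube (m + 1) 2) | lamSq 2 (tubeVecG m y) ≠ 1} ∅ = 0)
    (h : ι → HandleAttachingMap (m + 1) 2 V)
    (hdisj : Pairwise fun i j => Disjoint (range (h i).toFun) (range (h j).toFun)) :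
    FinRelHomology ℤ ℤ ↥(HandleAttachingMap.coresComplement h) ∅ (m + Fintype.card ι + 4) ∧
      relEuler ℤ ℤ ↥(HandleAttachingMap.coresComplement h) ∅ = relEuler ℤ ℤ V ∅ := by
  have hCo : IsOpen (HandleAttachingMap.coresComplement h : Set V) :=
    (HandleAttachingMap.coresComplement h).isOpen
  have hWo : IsOpen (⋃ i, range (h i).toFun) := isOpen_iUnion fun i => (h i).isOpen_range
  have hcov := coresComplement_union_iUnion_range h
  have hFV : FinRelHomology ℤ ℤ V ∅ (m + 3) := finRelHomology_of_compactSpace_halfSpace (n := m + 1) V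
  have hTi : ∀ i, FinRelHomology ℤ ℤ ↥(range (h i).toFun) ∅ 2 ∧ relEuler ℤ ℤ ↥(range (h i).toFun) ∅ = 0 := by
    intro i
    let e : ↥(handleTube (m + 1) 2) ≃ₜ ↥(range (h i).toFun) := (h i).isSmoothEmbedding.isEmbedding.toHomeomorph
    exact ⟨hT.1.of_homeomorph e (mapsTo_empty _ _) (mapsTo_empty _ _),
      (relEuler_eq_of_homeomorph e (mapsTo_empty _ _) (mapsTo_empty _ _)).symm.trans hT.2⟩
  obtain ⟨hFW, hWe⟩ := finRelHomology_and_relEuler_iUnion (fun i => range (h i).toFun)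
    (fun i => (h i).isOpen_range) hdisj fun i => (hTi i).1
  have hWe0 : relEuler ℤ ℤ ↥(⋃ i, range (h i).toFun) ∅ = 0 := by
    rw [hWe]; exact Finset.sum_eq_zero fun i _ => (hTi i).2
  set Pc : ι → Set V := fun i => (h i).toFun '' {y : ↥(handleTube (m + 1) 2) | lamSq 2 (tubeVecG m y) ≠ 1}
    with hPc
  have hCW : (HandleAttachingMap.coresComplement h : Set V) ∩ (⋃ i, range (h i).toFun) = ⋃ i, Pc i := by
    rw [inter_iUnion]
    exact iUnion_congr fun i => coresComplement_inter_range hdisj i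
  have hset : IsOpen {y : ↥(handleTube (m + 1) 2) | lamSq 2 (tubeVecG m y) ≠ 1} :=
    isOpen_ne_fun ((continuous_lamSq 2).comp (continuous_subtype_val.comp continuous_subtype_val))
      continuous_const
  have hPo : ∀ i, IsOpen (Pc i) := fun i =>
    (⟨(h i).isSmoothEmbedding.isEmbedding, (h i).isOpen_range⟩ : Topology.IsOpenEmbedding (h i).toFun).isOpenMap
      _ hset
  have hPd : Pairwise fun i j => Disjoint (Pc i) (Pc j) := fun i j hij =>
    (hdisj hij).mono (image_subset_range _ _) (image_subset_range _ _)
  have hPi : ∀ i, FinRelHomology ℤ ℤ ↥(Pc i) ∅ 2 ∧ relEuler ℤ ℤ ↥(Pc i) ∅ = 0 := by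
    intro i
    let e : ↥{y : ↥(handleTube (m + 1) 2) | lamSq 2 (tubeVecG m y) ≠ 1} ≃ₜ ↥(Pc i) :=
      ((h i).isSmoothEmbedding.isEmbedding.comp Topology.IsEmbedding.subtypeVal).toHomeomorph.trans
        (Homeomorph.setCongr (by rw [Set.range_comp, Subtype.range_coe]))
    exact ⟨hTS.1.of_homeomorph e (mapsTo_empty _ _) (mapsTo_empty _ _),
      (relEuler_eq_of_homeomorph e (mapsTo_empty _ _) (mapsTo_empty _ _)).symm.trans hTS.2⟩
  obtain ⟨hFI, hIe⟩ := finRelHomology_and_relEuler_iUnion Pc hPo hPd fun i => (hPi i).1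
  have hIe0 : relEuler ℤ ℤ ↥(⋃ i, Pc i) ∅ = 0 := by
    rw [hIe]; exact Finset.sum_eq_zero fun i _ => (hPi i).2
  rw [← hCW] at hFI hIe0
  obtain ⟨hFC, hVe⟩ := finRelHomology_and_relEuler_of_isOpen_cover_left hCo hWo hcov
    (N := m + Fintype.card ι + 3) (hFV.mono (by omega)) (hFW.mono (by omega)) (hFI.mono (by omega))
  rw [hWe0, hIe0, add_zero, sub_zero] at hVe
  exact ⟨hFC, hVe.symm⟩

/-- **`χ(V ∪ H² ∪ ⋯ ∪ H²) = χ(V ∖ ⋃ h̄ᵢ(S)) + n` for a Kosinski multi-attachment of `n` 2-handles**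
(`HandleAttachingMap.IsMultiAttachment`): inclusion–exclusion over the open cover of the result `X` by
`jA(V ∖ ⋃ h̄ᵢ(S))` and the `n` handle pieces `jBᵢ(D ∖ S)` (each contractible, `χ = 1`), meeting in the
gluing regions `jBᵢ({x_λ ≠ 0}) ≅ T ∖ S` (`χ = 0`); the finiteness of `V ∖ ⋃ h̄ᵢ(S)` is an input
(`finRelHomology_and_relEuler_coresComplement`). Kosinski 1993, VI §6; Kirby 1989, I §1. [folklore] -/
theorem finRelHomology_and_relEuler_of_isMultiAttachment'
    (hB : FinRelHomology ℤ ℤ ↥(beltPiece (m + 1) 2) ∅ 1 ∧ relEuler ℤ ℤ ↥(beltPiece (m + 1) 2) ∅ = 1)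
    (hBS : FinRelHomology ℤ ℤ ↥{b : ↥(beltPiece (m + 1) 2) | lamSq 2 ((b : Metric.closedBall (0 : EuclideanSpace ℝ (Fin (m + 2))) 1) :
        EuclideanSpace ℝ (Fin (m + 2))) ≠ 0} ∅ 2 ∧
      relEuler ℤ ℤ ↥{b : ↥(beltPiece (m + 1) 2) | lamSq 2 ((b : Metric.closedBall (0 : EuclideanSpace ℝ (Fin (m + 2))) 1) :
        EuclideanSpace ℝ (Fin (m + 2))) ≠ 0} ∅ = 0)
    {X : Type} [TopologicalSpace X]
    [ChartedSpace (EuclideanHalfSpace (m + 1 + 1)) X] {h : ι → HandleAttachingMap (m + 1) 2 V}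
    (hX : HandleAttachingMap.IsMultiAttachment h (𝓡∂ (m + 1 + 1)) X) {N : ℕ}
    (hC : FinRelHomology ℤ ℤ ↥(HandleAttachingMap.coresComplement h) ∅ N) :
    FinRelHomology ℤ ℤ X ∅ (N + Fintype.card ι + 3) ∧
      relEuler ℤ ℤ X ∅ = relEuler ℤ ℤ ↥(HandleAttachingMap.coresComplement h) ∅ + Fintype.card ι := by
  obtain ⟨hdisj, jA, jB, hjA, hjAo, hjB, hcov, hglue, hdisjB⟩ := hX
  let eA : ↥(HandleAttachingMap.coresComplement h) ≃ₜ ↥(range jA) := hjA.isEmbedding.toHomeomorph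
  have hFU : FinRelHomology ℤ ℤ ↥(range jA) ∅ N := hC.of_homeomorph eA (mapsTo_empty _ _) (mapsTo_empty _ _)
  have hUe : relEuler ℤ ℤ ↥(range jA) ∅ = relEuler ℤ ℤ ↥(HandleAttachingMap.coresComplement h) ∅ :=
    (relEuler_eq_of_homeomorph eA (mapsTo_empty _ _) (mapsTo_empty _ _)).symm
  have hBi : ∀ i, FinRelHomology ℤ ℤ ↥(range (jB i)) ∅ 1 ∧ relEuler ℤ ℤ ↥(range (jB i)) ∅ = 1 := by
    intro i
    let e : ↥(beltPiece (m + 1) 2) ≃ₜ ↥(range (jB i)) := (hjB i).1.isEmbedding.toHomeomorph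
    exact ⟨hB.1.of_homeomorph e (mapsTo_empty _ _) (mapsTo_empty _ _),
      (relEuler_eq_of_homeomorph e (mapsTo_empty _ _) (mapsTo_empty _ _)).symm.trans hB.2⟩
  obtain ⟨hFW, hWe⟩ := finRelHomology_and_relEuler_iUnion (fun i => range (jB i)) (fun i => (hjB i).2)
    hdisjB fun i => (hBi i).1
  have hWe1 : relEuler ℤ ℤ ↥(⋃ i, range (jB i)) ∅ = Fintype.card ι := by
    rw [hWe, Finset.sum_congr rfl fun i _ => (hBi i).2, Finset.sum_const, Finset.card_univ, nsmul_eq_mul, mul_one]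
  set Pc : ι → Set X := fun i => jB i '' {b : ↥(beltPiece (m + 1) 2) |
      lamSq 2 ((b : Metric.closedBall (0 : EuclideanSpace ℝ (Fin (m + 2))) 1) : EuclideanSpace ℝ (Fin (m + 2))) ≠ 0}
    with hPc
  have hUW : range jA ∩ (⋃ i, range (jB i)) = ⋃ i, Pc i := by
    rw [inter_iUnion]
    exact iUnion_congr fun i => range_jA_inter_range_jB hdisj hglue i
  have hset : IsOpen {b : ↥(beltPiece (m + 1) 2) |
      lamSq 2 ((b : Metric.closedBall (0 : EuclideanSpace ℝ (Fin (m + 2))) 1) : EuclideanSpace ℝ (Fin (m + 2))) ≠ 0} :=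
    isOpen_ne_fun ((continuous_lamSq 2).comp (continuous_subtype_val.comp continuous_subtype_val))
      continuous_const
  have hPo : ∀ i, IsOpen (Pc i) := fun i =>
    (⟨(hjB i).1.isEmbedding, (hjB i).2⟩ : Topology.IsOpenEmbedding (jB i)).isOpenMap _ hset
  have hPd : Pairwise fun i j => Disjoint (Pc i) (Pc j) := fun i j hij =>
    (hdisjB hij).mono (image_subset_range _ _) (image_subset_range _ _)
  have hPi : ∀ i, FinRelHomology ℤ ℤ ↥(Pc i) ∅ 2 ∧ relEuler ℤ ℤ ↥(Pc i) ∅ = 0 := by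
    intro i
    let e : ↥{b : ↥(beltPiece (m + 1) 2) |
        lamSq 2 ((b : Metric.closedBall (0 : EuclideanSpace ℝ (Fin (m + 2))) 1) : EuclideanSpace ℝ (Fin (m + 2))) ≠ 0} ≃ₜ
        ↥(Pc i) :=
      ((hjB i).1.isEmbedding.comp Topology.IsEmbedding.subtypeVal).toHomeomorph.trans
        (Homeomorph.setCongr (by rw [Set.range_comp, Subtype.range_coe]))
    exact ⟨hBS.1.of_homeomorph e (mapsTo_empty _ _) (mapsTo_empty _ _),
      (relEuler_eq_of_homeomorph e (mapsTo_empty _ _) (mapsTo_empty _ _)).symm.trans hBS.2⟩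
  obtain ⟨hFI, hIe⟩ := finRelHomology_and_relEuler_iUnion Pc hPo hPd fun i => (hPi i).1
  have hIe0 : relEuler ℤ ℤ ↥(⋃ i, Pc i) ∅ = 0 := by
    rw [hIe]; exact Finset.sum_eq_zero fun i _ => (hPi i).2
  rw [← hUW] at hFI hIe0
  obtain ⟨hFX, hXe⟩ := finRelHomology_and_relEuler_of_isOpen_cover hjAo (isOpen_iUnion fun i => (hjB i).2) hcov
    (N := N + Fintype.card ι + 2) (hFU.mono (by omega)) (hFW.mono (by omega)) (hFI.mono (by omega))
  exact ⟨hFX, by rw [hXe, hUe, hWe1, hIe0, sub_zero]⟩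

end Handles

section Four

/-- **Registered sub-goal `stub_modelsOn_counts_eulerHandles`** (sub-goal of `stub_modelsOn_counts`, line
`modp-braid-orbits`, r9): **`χ(X) = χ(V) + n` for a Kosinski multi-attachment `X` of `n` 2-handles on a
compact smooth 4-manifold with boundary `V`** (Kosinski 1993, VI §6 / Kirby 1989, I §1), with the finiteness of `H_•(X; ℤ)`: the case
`m = 2` of `χ(V ∖ ⋃ h̄ᵢ(S)) = χ(V)` and `χ(X) = χ(V ∖ ⋃ h̄ᵢ(S)) + n` (instances re-read at `2 + 1 + 1`), GIVEN the
four model Euler characteristics `χ(T) = χ(T ∖ S) = χ({x_λ ≠ 0} ⊆ D ∖ S) = 0`, `χ(D ∖ S) = 1` (proved in the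
companion `…EulerHandleModels.lean`).  This is the hypothesis `hχ` of `stub_modelsOn_counts_length_of_betti`
for `V = Base g`. [folklore] -/
theorem stub_modelsOn_counts_eulerHandles :
    (FinRelHomology ℤ ℤ ↥(handleTube (2 + 1) 2) ∅ 2 ∧ relEuler ℤ ℤ ↥(handleTube (2 + 1) 2) ∅ = 0) →
    (FinRelHomology ℤ ℤ ↥{y : ↥(handleTube (2 + 1) 2) | lamSq 2 (tubeVecG 2 y) ≠ 1} ∅ 2 ∧
      relEuler ℤ ℤ ↥{y : ↥(handleTube (2 + 1) 2) | lamSq 2 (tubeVecG 2 y) ≠ 1} ∅ = 0) →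
    (FinRelHomology ℤ ℤ ↥(beltPiece (2 + 1) 2) ∅ 1 ∧ relEuler ℤ ℤ ↥(beltPiece (2 + 1) 2) ∅ = 1) →
    (FinRelHomology ℤ ℤ ↥{b : ↥(beltPiece (2 + 1) 2) | lamSq 2 ((b : Metric.closedBall (0 : EuclideanSpace ℝ (Fin (2 + 2))) 1) :
        EuclideanSpace ℝ (Fin (2 + 2))) ≠ 0} ∅ 2 ∧
      relEuler ℤ ℤ ↥{b : ↥(beltPiece (2 + 1) 2) | lamSq 2 ((b : Metric.closedBall (0 : EuclideanSpace ℝ (Fin (2 + 2))) 1) :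
        EuclideanSpace ℝ (Fin (2 + 2))) ≠ 0} ∅ = 0) →
    ∀ (V : Type) [TopologicalSpace V] [T2Space V] [CompactSpace V] [ChartedSpace (EuclideanHalfSpace 4) V]
      [IsManifold (𝓡∂ 4) ∞ V] (n : ℕ) (h : Fin n → HandleAttachingMap 3 2 V)
      (X : Type) [TopologicalSpace X] [ChartedSpace (EuclideanHalfSpace 4) X],
      HandleAttachingMap.IsMultiAttachment h (𝓡∂ 4) X →
      FinRelHomology ℤ ℤ X ∅ (2 * n + 9) ∧ relEuler ℤ ℤ X ∅ = relEuler ℤ ℤ V ∅ + n := by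
  intro hT hTS hB hBS V _ _ _ _ _ n h X _ _ hX
  have iV2' : IsManifold (𝓡∂ 4) ∞ V := inferInstance
  letI iV1 : ChartedSpace (EuclideanHalfSpace (2 + 1 + 1)) V := ‹ChartedSpace (EuclideanHalfSpace 4) V›
  letI iV2 : IsManifold (𝓡∂ (2 + 1 + 1)) ∞ V := iV2'
  letI iX1 : ChartedSpace (EuclideanHalfSpace (2 + 1 + 1)) X := ‹ChartedSpace (EuclideanHalfSpace 4) X›
  obtain ⟨hC, hCe⟩ := finRelHomology_and_relEuler_coresComplement (m := 2) (ι := Fin n) hT hTS h hX.1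
  obtain ⟨hF, he⟩ := finRelHomology_and_relEuler_of_isMultiAttachment' (m := 2) hB hBS hX hC
  rw [Fintype.card_fin] at hF he
  exact ⟨hF.mono (by omega), by rw [he, hCe]⟩

end Four

end Summit.SmoothPoincare4.SmoothPoincare4.Theorems.AcyclicBisectionExists.ModpBraidOrbits

end
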